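import Literature.MathematicalPhysics.QuantumFieldTheory.Balaban1983to89.StrongCouplingKPWindow
import Literature.MathematicalPhysics.QuantumFieldTheory.LatticeGaugeDobrushin
import Literature.Probability.LatticeModels.LatticeAnimals
import HarnessLib

/-!
# Instrument cell `ym-instrument`, crew (b): the KERNEL lattice-animal bound for the polymer counts of the tree's Kotecký–Preiss window —
# `closedCount 4 n ≤ 6 · 441^(n−1)` for every `n` (and `closedCount 4 0 = 0`), from `LatticeAnimals` BY NAME

QUESTIONS.md rows: Q-B1 (REGISTERED 2026-08-26T13:54:11Z; readings A-0826-8, A-0826-16); certs/b/FORMAT.md v1.3 §3b (the `counts`/`tail` columns of a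
`kp` object); cell `run/shared/lean/pub/ym-instrument/`, HUMAN RULING D-0084 (2), director-ym R138.  HONEST FRAMING (page 1, binding).  WHAT IS CERTIFIED
HERE AND AT WHICH `(G, D, L, β)`: PURE LATTICE COMBINATORICS of `ℤ⁴` (no group, no coupling, no measure): the number `closedCount 4 n` of closed
link-connected `n`-plaquette complexes of `ℤ⁴` through the fixed root link — the coefficient sequence of the tree's computable criterion
`Balaban1983to89.StrongCouplingKPWindow.KPCriterionSU2` — is bounded by `6 · 441^(n−1)` for EVERY `n`, by instantiating the tree's kernel lemma
`Literature.Probability.LatticeModels.LatticeAnimals` — the general kernel count is `card_connectedFamily_le` (cited by the KPWindow docstring); we use its two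
ingredients `exists_lazyWalk_cover`, `card_lazyWalks_le` (a connected `n`-set is traced by a closed lazy walk of length `2(n−1)`; at most `(Δ+1)^{2(n−1)}` such walks) — on the plaquettes of `ℤ⁴` with the share-a-link adjacency: `Δ = 20` (a plaquette has `4` links —
`card_plaquetteEdges_le` —, a link of `ℤ⁴` lies in `2(d−1) = 6` plaquettes — `card_plaquettesTouching_singleton_le`, both tree lemmas of `LatticeGaugeDobrushin`),
`6` plaquettes through the root link.  This is the «kernel lemma `6·441^{n−1}`» named in the docstring of the tree's `TailBoundT2` (J-SC1 certificate, pub-balaban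
`FRONT-SC.md` §3: window `0.00188` at census depth `10`) — never typed before; closedness is not even used.  WHAT THIS IS FOR: it is the ONLY tail bound on
`closedCount` that is a tree THEOREM (the sharper `TailBoundT2 = 0.7·14.95ⁿ` and sc-eng-2's Lemma C `≤ C(10n+1, n)` are paper-level, Lean OPEN), hence the only
route today to a HYPOTHESIS-FREE instance of `KPCriterionSU2` (companion file `KPCriterionSU2Unconditional`: window `β_W ≤ 33/20000 = 0.00165`, a factor `28`
inside the certified-conditional `r★ = 0.047` and a factor `170` inside the hypothesis-free SC-c door `2/7`; reading rule A-0826-16: a number inside `[0, 0.328)`,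
never a path to the door).  NOT a clustering statement, NOT a mass gap, NOT summit-bearing.  Grade (T): every statement below is a hypothesis-free kernel theorem.
-/

noncomputable section

open Finset
open Literature.MathematicalPhysics.QuantumLattice (ZdEdge ZdPlaquette plaquetteEdges plaquettesTouching)
open Literature.MathematicalPhysics.QuantumFieldTheory (mem_plaquettesTouching_singleton card_plaquettesTouching_singleton_le card_plaquetteEdges_le)
open Literature.MathematicalPhysics.QuantumFieldTheory.Balaban1983to89.StrongCouplingKPWindow
  (links IsClosedComplex IsLinkConnected rootLink closedCount)
open Literature.Probability.LatticeModels (lazyWalks card_lazyWalks_le exists_lazyWalk_cover)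

namespace Summit.QuantumFields.YangMills.Theorems.Instrument.ClosedComplexCountBound

variable {d : ℕ}

/-! ## §1 The share-a-link adjacency of plaquettes: at most `4(2(d−1) − 1)` neighbours (`20` for `d = 4`) -/

/-- The neighbour list of a plaquette: the other plaquettes through each of its four links (the tree's `plaquettesTouching {e}`). [folklore] -/
def nbr (p : ZdPlaquette d) : Finset (ZdPlaquette d) := (plaquetteEdges p).biUnion fun e => (plaquettesTouching {e}).erase p

/-- `#nbr p ≤ 4 · (2(d−1) − 1)` (tree lemmas `card_plaquetteEdges_le`, `card_plaquettesTouching_singleton_le`). [folklore] -/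
theorem card_nbr_le (p : ZdPlaquette d) : (nbr p).card ≤ 4 * (2 * (d - 1) - 1) := by
  unfold nbr
  refine (card_biUnion_le_card_mul _ _ (2 * (d - 1) - 1) fun e he => ?_).trans
    (Nat.mul_le_mul_right _ (card_plaquetteEdges_le p))
  rw [card_erase_of_mem (mem_plaquettesTouching_singleton.2 he)]
  exact Nat.sub_le_sub_right (card_plaquettesTouching_singleton_le e) 1

/-- For `d = 4`: at most `20` neighbours. [folklore] -/
theorem card_nbr_le_twenty (p : ZdPlaquette 4) : (nbr p).card ≤ 20 := (card_nbr_le p).trans (by norm_num)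

/-- The adjacency «distinct plaquettes sharing a link» (written inline as `p ≠ q ∧ ¬ Disjoint (plaquetteEdges p) (plaquetteEdges q)`)
is symmetric. [folklore] -/
theorem adj_symm {p q : ZdPlaquette d} (h : p ≠ q ∧ ¬ Disjoint (plaquetteEdges p) (plaquetteEdges q)) :
    q ≠ p ∧ ¬ Disjoint (plaquetteEdges q) (plaquetteEdges p) :=
  ⟨h.1.symm, fun hd => h.2 hd.symm⟩

/-- An adjacent plaquette is listed in `nbr`. [folklore] -/
theorem mem_nbr_of_adj {p q : ZdPlaquette d} (h : p ≠ q ∧ ¬ Disjoint (plaquetteEdges p) (plaquetteEdges q)) : q ∈ nbr p := by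
  obtain ⟨e, hep, heq⟩ := not_disjoint_iff.1 h.2
  unfold nbr
  exact mem_biUnion.2 ⟨e, hep, mem_erase.2 ⟨h.1.symm, mem_plaquettesTouching_singleton.2 heq⟩⟩

/-- A link-connected complex is connected inside itself, for the adjacency «distinct and sharing a link», from any of its plaquettes (the idle
steps `a = b` allowed by the tree's relation are dropped). [folklore] -/
theorem reflTransGen_adj_of_isLinkConnected {X : Finset (ZdPlaquette d)} (hX : IsLinkConnected X) {p : ZdPlaquette d}
    (hp : p ∈ X) : ∀ w ∈ X, Relation.ReflTransGen
      (fun x y => (x ≠ y ∧ ¬ Disjoint (plaquetteEdges x) (plaquetteEdges y)) ∧ x ∈ X ∧ y ∈ X) p w := by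
  intro w hw
  have h := hX p hp w hw
  clear hw
  induction h with
  | refl => exact Relation.ReflTransGen.refl
  | @tail b c _ hbc ih =>
    obtain ⟨hb, hc, hnd⟩ := hbc
    by_cases hbc' : b = c
    · exact hbc' ▸ ih
    · exact ih.tail ⟨⟨hbc', hnd⟩, hb, hc⟩

/-! ## §2 ★ The count: `closedCount 4 n ≤ 6 · 441^(n−1)` -/

/-- The finite family that contains every rooted link-connected `n`-complex: vertex sets of closed lazy walks of length `2(n−1)` started at one of
the (at most six) plaquettes through the root link. [folklore] -/
def coverFamily (n : ℕ) : Finset (Finset (ZdPlaquette 4)) :=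
  (plaquettesTouching {rootLink 4}).biUnion fun p => (lazyWalks nbr p (2 * (n - 1))).image List.toFinset

/-- Every link-connected `n`-complex through the root link belongs to `coverFamily n` (`LatticeAnimals.exists_lazyWalk_cover`). [folklore] -/
theorem mem_coverFamily {n : ℕ} {X : Finset (ZdPlaquette 4)} (hcard : X.card = n) (hroot : rootLink 4 ∈ links X)
    (hconn : IsLinkConnected X) : X ∈ coverFamily n := by
  unfold links at hroot
  obtain ⟨p, hpX, hpe⟩ := mem_biUnion.1 hroot
  have hS := reflTransGen_adj_of_isLinkConnected hconn hpX
  obtain ⟨l, hl, hlX, -⟩ := exists_lazyWalk_cover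
    (R := fun x y : ZdPlaquette 4 => x ≠ y ∧ ¬ Disjoint (plaquetteEdges x) (plaquetteEdges y)) (nbr := nbr)
    (fun _ _ h => adj_symm h) (fun _ _ h => mem_nbr_of_adj h) hpX hS
  rw [hcard] at hl
  unfold coverFamily
  exact mem_biUnion.2 ⟨p, mem_plaquettesTouching_singleton.2 hpe, mem_image.2 ⟨l, hl, hlX⟩⟩

/-- `#coverFamily n ≤ 6 · 441^(n−1)` (`LatticeAnimals.card_lazyWalks_le` with `Δ = 20`, six roots). [folklore] -/
theorem card_coverFamily_le (n : ℕ) : (coverFamily n).card ≤ 6 * 441 ^ (n - 1) := by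
  unfold coverFamily
  refine (card_biUnion_le_card_mul _ _ (441 ^ (n - 1)) fun p _ => ?_).trans ?_
  · refine card_image_le.trans ((card_lazyWalks_le (Δ := 20) card_nbr_le_twenty p _).trans ?_)
    rw [pow_mul]
    norm_num
  · exact Nat.mul_le_mul_right _ ((card_plaquettesTouching_singleton_le (rootLink 4)).trans (by norm_num))

/-- ★ **`closedCount 4 n ≤ 6 · 441^(n−1)` for every `n`** (the kernel lattice-animal tail of the tree's Kotecký–Preiss window; closedness unused).
[folklore] -/
theorem closedCount_four_le (n : ℕ) : closedCount 4 n ≤ 6 * 441 ^ (n - 1) := by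
  unfold closedCount
  have hsub : {X : Finset (ZdPlaquette 4) | X.card = n ∧ rootLink 4 ∈ links X ∧ IsLinkConnected X ∧ IsClosedComplex X} ⊆
      (↑(coverFamily n) : Set (Finset (ZdPlaquette 4))) :=
    fun X hX => mem_coe.2 (mem_coverFamily hX.1 hX.2.1 hX.2.2.1)
  calc Nat.card {X : Finset (ZdPlaquette 4) // X.card = n ∧ rootLink 4 ∈ links X ∧ IsLinkConnected X ∧ IsClosedComplex X}
      = ({X : Finset (ZdPlaquette 4) | X.card = n ∧ rootLink 4 ∈ links X ∧ IsLinkConnected X ∧ IsClosedComplex X}).ncard :=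
        Nat.card_coe_set_eq _
    _ ≤ (↑(coverFamily n) : Set (Finset (ZdPlaquette 4))).ncard := Set.ncard_le_ncard hsub (finite_toSet _)
    _ = (coverFamily n).card := Set.ncard_coe_finset _
    _ ≤ 6 * 441 ^ (n - 1) := card_coverFamily_le n

/-- `closedCount 4 0 = 0`: the empty complex has no links. [folklore] -/
theorem closedCount_four_zero : closedCount 4 0 = 0 := by
  unfold closedCount
  haveI : IsEmpty {X : Finset (ZdPlaquette 4) // X.card = 0 ∧ rootLink 4 ∈ links X ∧ IsLinkConnected X ∧ IsClosedComplex X} :=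
    ⟨fun ⟨X, hX0, hroot, _, _⟩ => by
      rw [Finset.card_eq_zero] at hX0
      subst hX0
      simp [links] at hroot⟩
  exact Nat.card_of_isEmpty

/-- ★ Real-valued form for the KP sum: `(closedCount 4 n : ℝ) ≤ 6 · 441^(n−1)`. [folklore] -/
theorem closedCount_four_le_real (n : ℕ) : (closedCount 4 n : ℝ) ≤ 6 * (441 : ℝ) ^ (n - 1) := by
  exact_mod_cast closedCount_four_le n

end Summit.QuantumFields.YangMills.Theorems.Instrument.ClosedComplexCountBound

end
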